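import Summits.BirchSwinnertonDyer.Rank1Residual.Additive.KobayashiTowerPoints
import Summits.BirchSwinnertonDyer.Rank1Residual.Additive.PadicBallLogSurj
import Summits.BirchSwinnertonDyer.Rank1Residual.Additive.PadicCyclotomicIntegers
import HarnessLib

/-!
# Kobayashi's generation step (Prop. 8.11/8.12 ii)): every `P ∈ E₁(ℚ_p(ζ_{p^m}))` is, modulo
# `E(ℚ_p(ζ_{p^{m−1}}))` and `p·E₁`, an integral combination of the Galois conjugates of `c_m`; and the
# trace relations `Tr_{m/m−1} c_{m+1} + c_{m−1} ∈ E(ℚ_p)` (cell `b2b-bsdres`, CLASS-CLOSURE lane, class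
# O10 — x1b GEN 33, class lead; file 35 of the local series: the formal-group GENERATION statement
# behind `hsum`, over `ℚ̄_p`, for a good supersingular `a_p = 0` model and `p` odd)

HONEST FRAMING (cell `b2b-bsdres`, run/shared/lean/b2b/bsd-rank1-residual/, verbatim in every
file): the goal of the cell is to DELETE the COMBINATION-SHAPED residual classes of the
Birch–Swinnerton-Dyer formula for ALL analytic-rank `≤ 1` elliptic curves over `ℚ` — "full BSD
formula for every rank `≤ 1` curve in class `C`" assembled STRICTLY from published theorems — so
that the rank-`≤ 1` remainder becomes exactly the CONSTRUCTION-SHAPED classes, which are TYPED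
(missing-input `Prop`s), NOT attempted. This is not "finishing BSD". CLASS-CLOSURE lane: prove
what is provable now; shrink each hard class to its core with data; no claim beyond stated classes;
research routes on CONSTRUCTION-SHAPED X12 / O10; census / instrument output = EVIDENCE / conjecture
items, NEVER a Literature fact; `RESIDUAL-MAP.md` marks change only by signed lines. THIS FILE:
TOOL THEOREMS ONLY (every statement proved) — no definition, no named Literature fact, no
Summits-side fact `def … : Prop`, no `sorry`, axioms standard; nothing is booked; no label / mark /
count / sub-cell moves; O10 stays OPEN / CONSTRUCTION-SHAPED; nothing about `BSD(W, p)` of any pair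
is claimed.

## Content (notation of files 33–34; `act` a coordinatewise action of `Γ` on `E_Ω`-points)

* §1 bookkeeping: `L(m') ≤ L(m)` for `m' ≤ m`, `Λ` of finite sums, the Frobenius hypothesis of file 31
  for `(K_m, K_{m−1})` (from file 32), closure correspondence `ℤ[Γ·ζ_m] → ℤ[Γ·c_m]` under `Λ` modulo
  `layer (m−1)`.
* §2 **`exists_sub_closure_sub_smul_mem`** ([K] Prop. 8.11 ⇒ 8.12 ii) generation step): for `m ≥ 1`
  and `P ∈ L(m) ∩ E₁` there are `B ∈ ℤ[Γ·c_m]` and `R ∈ L(m) ∩ E₁` with `P − B − p•R ∈ L(m−1)`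
  (given: `L(m)` has no `p`-power torsion).
* §3 **`sum_act_cPt_add_mem`**: `(∑_{q ∈ stab m/stab (m+1)} act q̃ c_{m+1}) + c_{m−1} ∈ L(0)` (`m ≥ 1`)
  and `∑_{q ∈ Γ/stab 1} act q̃ c_1 ∈ L(0)` — the trace relations of [K] Lemma 8.9 read through `Λ`.

References: [Kobayashi2003] §8.4 (Lemma 8.9, Prop. 8.11, Prop. 8.12 ii)).
-/

noncomputable section

open scoped Classical Topology NNReal
open Filter PowerSeries Finset

namespace Summit.BirchSwinnertonDyer.Rank1Residual.Additive

namespace BallEval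

open Literature.NumberTheory.GaloisRepresentations.LubinTate (unitBall mem_unitBall_iff)
open Literature.NumberTheory.EllipticCurves Literature.NumberTheory.EllipticCurves.FormalGroupChart
open WeierstrassCurve PadicCyclotomicTower HondaFss Field

variable (p : ℕ) [hp : Fact p.Prime] (M : WeierstrassCurve ℤ_[p])
  [hE : (M.map PadicInt.Coe.ringHom).IsElliptic] [hEt : (M.map PadicInt.toZMod).IsElliptic]
  (hp2 : p ≠ 2) (htr : Literature.NumberTheory.EllipticCurves.HasseManin.tr (M.map PadicInt.toZMod) = 0)


variable {p M hp2 htr}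
variable [hintΩ : (genFibΩ p M).IsIntegral (Valued.v (R := PadicAlgCl p)).integer]

/-! ## §1 Bookkeeping -/

omit hE hEt hintΩ in
/-- `L(m') ≤ L(m)` for `m' ≤ m`. [folklore] -/
theorem subfieldPoints_layer_mono {m' m : ℕ} (h : m' ≤ m) :
    subfieldPoints (genFibΩ p M) (layer p m').toSubfield coeffs_mem_layer ≤ subfieldPoints (genFibΩ p M) (layer p m).toSubfield coeffs_mem_layer := by
  intro Q hQ
  rcases Q with _ | ⟨x, y, hxy⟩
  · exact (subfieldPoints _ _ _).zero_mem
  · obtain ⟨hx, hy⟩ := (some_mem_subfieldPoints_iff _ hxy).mp hQ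
    rw [some_mem_subfieldPoints_iff]
    exact ⟨layer_mono p h hx, layer_mono p h hy⟩

omit hEt in
/-- `Λ` of a finite sum of points of `L(m) ∩ E₁`. [folklore] -/
theorem ptLogΩ_finset_sum {ι : Type*} (s : Finset ι) (Q : ι → (genFibΩ p M).toAffine.Point) {m : ℕ}
    (hL : ∀ i ∈ s, Q i ∈ subfieldPoints (genFibΩ p M) (layer p m).toSubfield coeffs_mem_layer)
    (hk : ∀ i ∈ s, Q i ∈ kernel (Valued.v (R := PadicAlgCl p)) (genFibΩ p M)) :
    ptLogΩ p M (∑ i ∈ s, Q i) = ∑ i ∈ s, ptLogΩ p M (Q i) := by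
  haveI := isIntegral_curveK p (LayerField p m) M
  induction s using Finset.induction_on with
  | empty => rw [sum_empty, sum_empty, ptLogΩ_zero]
  | @insert i s hi ih =>
    have hLs : ∀ j ∈ s, Q j ∈ subfieldPoints (genFibΩ p M) (layer p m).toSubfield coeffs_mem_layer := fun j hj => hL j (mem_insert_of_mem hj)
    have hks : ∀ j ∈ s, Q j ∈ kernel (Valued.v (R := PadicAlgCl p)) (genFibΩ p M) := fun j hj => hk j (mem_insert_of_mem hj)
    rw [sum_insert hi, sum_insert hi, ptLogΩ_add (m := m) (hL i (mem_insert_self i s))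
      ((subfieldPoints _ _ _).sum_mem hLs) (hk i (mem_insert_self i s))
      ((kernel (Valued.v (R := PadicAlgCl p)) (genFibΩ p M)).sum_mem hks), ih hLs hks]

omit hE hEt hintΩ in
/-- The Frobenius hypothesis of file 31 for `(K_m, K_{m−1})`, from the cyclotomic congruence of file 32.
[cite: Kobayashi2003, Prop. 8.11] -/
theorem frob_layerField (hp2 : p ≠ 2) {m : ℕ} (hm : 1 ≤ m) (y : LayerField p m) (hy : ‖y‖ ≤ 1) :
    ∃ s ∈ Subfield.comap (LayerField.emb p m).toRingHom (layer p (m - 1)).toSubfield,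
      ‖s‖ ≤ 1 ∧ ‖y ^ p - s‖ ≤ ‖(p : LayerField p m)‖ := by
  have hy' : ‖LayerField.emb p m y‖ ≤ 1 := by rwa [LayerField.norm_emb]
  obtain ⟨s, hs, hs1, hys⟩ := exists_frob_mem_layer_pred p hp2 hm (LayerField.emb_mem y) hy'
  refine ⟨LayerField.mk p m s (layer_mono p (Nat.sub_le m 1) hs), ?_, ?_, ?_⟩
  · change LayerField.emb p m (LayerField.mk p m s _) ∈ (layer p (m - 1)).toSubfield
    rw [LayerField.emb_mk]; exact hs
  · rw [← LayerField.norm_emb, LayerField.emb_mk]; exact hs1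
  · rw [← LayerField.norm_emb, map_sub, map_pow, LayerField.emb_mk, ← LayerField.norm_emb (p := p) (m := m) (p : LayerField p m),
      map_natCast]
    exact hys

omit hE hEt hintΩ in
/-- The tail of `ℓ_m` lies in `layer (m−1)`: `ℓ_m − (ζ_m − 1) ∈ layer (m − 1)` (`m ≥ 1`). [folklore] -/
theorem ell_sub_mem_layer_pred {m : ℕ} (hm : 1 ≤ m) : ell p m - (zeta p m - 1) ∈ layer p (m - 1) := by
  obtain ⟨m', rfl⟩ := Nat.exists_eq_add_of_le' hm
  rw [ell_succ, add_sub_cancel_left, Nat.add_sub_cancel]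
  refine Subalgebra.sum_mem _ fun k _ => ?_
  have hz : zeta p (m' + 1 - 2 * (k + 1)) ∈ layer p m' :=
    layer_mono p (by omega) (zeta_mem_layer p (m' + 1 - 2 * (k + 1)))
  refine IntermediateField.div_mem _ ?_ ?_
  · exact Subalgebra.mul_mem _ (Subalgebra.pow_mem _ (Subalgebra.neg_mem _ (Subalgebra.one_mem _)) _)
      (IntermediateField.sub_mem _ hz (IntermediateField.one_mem _))
  · exact Subalgebra.pow_mem _ (by exact_mod_cast IntermediateField.natCast_mem (layer p m') p) _

/-- **The closure correspondence**: every `z ∈ ℤ[Γ·ζ_m]` is `Λ(B)` modulo `layer (m−1)` for some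
`B ∈ ℤ[Γ·c_m] ⊆ L(m) ∩ E₁`. [cite: Kobayashi2003, Prop. 8.11] -/
theorem exists_closure_pt (act : Field.absoluteGaloisGroup ℚ_[p] → (genFibΩ p M).toAffine.Point → (genFibΩ p M).toAffine.Point)
    (hact0 : ∀ σ, act σ 0 = 0)
    (hact : ∀ σ (x y : PadicAlgCl p) (h : (genFibΩ p M).toAffine.Nonsingular x y),
      ∃ h', act σ (Affine.Point.some x y h) = Affine.Point.some (σ • x) (σ • y) h')
    {m : ℕ} (hm : 1 ≤ m) {z : PadicAlgCl p}
    (hz : z ∈ AddSubgroup.closure (Set.range fun σ : Field.absoluteGaloisGroup ℚ_[p] => σ • zeta p m)) :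
    ∃ B ∈ AddSubgroup.closure (Set.range fun σ : Field.absoluteGaloisGroup ℚ_[p] => act σ (cPt p M hp2 htr m)),
      B ∈ subfieldPoints (genFibΩ p M) (layer p m).toSubfield coeffs_mem_layer ∧
      B ∈ kernel (Valued.v (R := PadicAlgCl p)) (genFibΩ p M) ∧ ptLogΩ p M B - z ∈ layer p (m - 1) := by
  haveI := isIntegral_curveK p (LayerField p m) M
  have hcL := cPt_mem_subfieldPoints (p := p) (M := M) (hp2 := hp2) (htr := htr) m
  have hck : cPt p M hp2 htr m ∈ kernel (Valued.v (R := PadicAlgCl p)) (genFibΩ p M) := cPt_mem_kernel m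
  have hcz : ‖(cPt p M hp2 htr m).zCoord‖ < 1 := by
    have := val_zCoord_lt_one hck
    rwa [PadicAlgCl.valuation_def, ← NNReal.coe_lt_coe, coe_nnnorm, NNReal.coe_one] at this
  induction hz using AddSubgroup.closure_induction with
  | mem x hx =>
    obtain ⟨σ, rfl⟩ := hx
    refine ⟨act σ (cPt p M hp2 htr m), AddSubgroup.subset_closure ⟨σ, rfl⟩,
      act_mem_subfieldPoints act hact0 hact σ hcL, act_mem_kernel act hact0 hact σ hck, ?_⟩
    rw [ptLogΩ_act act hact0 hact σ hcz, ptLogΩ_cPt]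
    -- `σ • ℓ_m − σ • ζ_m = σ • (ℓ_m − (ζ_m − 1)) − 1`
    have e : σ • ell p m - σ • zeta p m = σ • (ell p m - (zeta p m - 1)) - 1 := by
      rw [smul_sub, smul_sub, smul_one]; ring
    change σ • ell p m - σ • zeta p m ∈ layer p (m - 1)
    rw [e]
    exact IntermediateField.sub_mem _ (smul_mem_layer σ (ell_sub_mem_layer_pred hm)) (IntermediateField.one_mem _)
  | zero =>
    refine ⟨0, AddSubgroup.zero_mem _, (subfieldPoints _ _ _).zero_mem,
      (kernel (Valued.v (R := PadicAlgCl p)) (genFibΩ p M)).zero_mem, ?_⟩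
    rw [ptLogΩ_zero, sub_zero]; exact IntermediateField.zero_mem _
  | add x y _ _ ihx ihy =>
    obtain ⟨B₁, hB₁, hB₁L, hB₁k, h₁⟩ := ihx
    obtain ⟨B₂, hB₂, hB₂L, hB₂k, h₂⟩ := ihy
    refine ⟨B₁ + B₂, AddSubgroup.add_mem _ hB₁ hB₂, (subfieldPoints _ _ _).add_mem hB₁L hB₂L,
      (kernel (Valued.v (R := PadicAlgCl p)) (genFibΩ p M)).add_mem hB₁k hB₂k, ?_⟩
    rw [ptLogΩ_add (m := m) hB₁L hB₂L hB₁k hB₂k]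
    have e : ptLogΩ p M B₁ + ptLogΩ p M B₂ - (x + y) = (ptLogΩ p M B₁ - x) + (ptLogΩ p M B₂ - y) := by ring
    rw [e]; exact IntermediateField.add_mem _ h₁ h₂
  | neg x _ ih =>
    obtain ⟨B, hB, hBL, hBk, h⟩ := ih
    refine ⟨-B, AddSubgroup.neg_mem _ hB, (subfieldPoints _ _ _).neg_mem hBL,
      (kernel (Valued.v (R := PadicAlgCl p)) (genFibΩ p M)).neg_mem hBk, ?_⟩
    have hneg : ptLogΩ p M (-B) = -ptLogΩ p M B := by
      have h0 := ptLogΩ_sub (m := m) (subfieldPoints _ _ _).zero_mem hBL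
        (kernel (Valued.v (R := PadicAlgCl p)) (genFibΩ p M)).zero_mem hBk
      rw [zero_sub, ptLogΩ_zero, zero_sub] at h0
      exact h0
    rw [hneg]
    have e : -ptLogΩ p M B - -x = -(ptLogΩ p M B - x) := by ring
    rw [e]; exact IntermediateField.neg_mem _ h

/-! ## §2 The generation step -/

/-- **Kobayashi's generation step** ([K] Prop. 8.11 ⇒ Prop. 8.12 ii)): for `m ≥ 1`, `p` odd, a good
supersingular `a_p = 0` model, and `P ∈ L(m) ∩ E₁` (a point of `E₁(ℚ_p(ζ_{p^m}))`), there are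
`B ∈ ℤ[Γ·c_m]` and `R ∈ L(m) ∩ E₁` with `P − B − p•R ∈ L(m−1)` — provided `L(m)` has no `p`-power
torsion and `act` is additive on differences. Proof: `Λ(P) ∈ K_{m−1} + 𝒪_m` (Honda, file 31),
`𝒪_m ⊆ ℤ[Γ·ζ_m] + K_{m−1} + p³𝒪_m` (file 32), `p³𝒪_m ⊆ Λ(p·E₁)` (file 30), `ℤ[Γ·ζ_m] ≡ Λ(ℤ[Γ·c_m])`
modulo `K_{m−1}` (file 34), and a point of `L(m) ∩ E₁` with logarithm in `K_{m−1}` lies in `L(m−1)`.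
[cite: Kobayashi2003, Prop. 8.11, Prop. 8.12] -/
theorem exists_sub_closure_sub_smul_mem (act : Field.absoluteGaloisGroup ℚ_[p] → (genFibΩ p M).toAffine.Point → (genFibΩ p M).toAffine.Point)
    (hact0 : ∀ σ, act σ 0 = 0)
    (hact : ∀ σ (x y : PadicAlgCl p) (h : (genFibΩ p M).toAffine.Nonsingular x y),
      ∃ h', act σ (Affine.Point.some x y h) = Affine.Point.some (σ • x) (σ • y) h')
    {m : ℕ} (hm : 1 ≤ m)
    (htors : ∀ Q ∈ subfieldPoints (genFibΩ p M) (layer p m).toSubfield coeffs_mem_layer, ∀ k : ℕ, p ^ k • Q = 0 → Q = 0)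
    {P : (genFibΩ p M).toAffine.Point} (hP : P ∈ subfieldPoints (genFibΩ p M) (layer p m).toSubfield coeffs_mem_layer)
    (hPk : P ∈ kernel (Valued.v (R := PadicAlgCl p)) (genFibΩ p M)) :
    ∃ B ∈ AddSubgroup.closure (Set.range fun σ : Field.absoluteGaloisGroup ℚ_[p] => act σ (cPt p M hp2 htr m)),
      ∃ R ∈ subfieldPoints (genFibΩ p M) (layer p m).toSubfield coeffs_mem_layer,
        R ∈ kernel (Valued.v (R := PadicAlgCl p)) (genFibΩ p M) ∧
        P - B - p • R ∈ subfieldPoints (genFibΩ p M) (layer p (m - 1)).toSubfield coeffs_mem_layer := by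
  haveI := isIntegral_curveK p (LayerField p m) M
  -- lift `P` to `K = K_m`
  obtain ⟨PK, rfl⟩ := exists_toOmega_eq hP
  have hPKk : PK ∈ kernel (NormedField.valuation (K := LayerField p m)) (curveK p (LayerField p m) M) :=
    (toOmega_mem_kernel_iff PK).mp hPk
  -- (BR1): `Λ(P) = μ₀ + y`, `μ₀ ∈ K_{m−1}`, `‖y‖ ≤ 1`
  set K' : Subfield (LayerField p m) := Subfield.comap (LayerField.emb p m).toRingHom (layer p (m - 1)).toSubfield with hK'
  obtain ⟨μ₀, hμ₀, hμ₀y⟩ := exists_mem_norm_ptLog_sub_le_one (hp2 := hp2) (htr := htr) K' (frob_layerField hp2 hm) hPKk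
  set y : LayerField p m := ptLog p (LayerField p m) M PK - μ₀ with hy
  have hμ₀L : LayerField.emb p m μ₀ ∈ layer p (m - 1) := hμ₀
  -- (DEC): `emb y − p³ y'Ω ∈ ℤ[Γ·ζ_m] + layer (m−1)`
  obtain ⟨y'Ω, hy'L, hy'1, hdec⟩ := exists_sub_pow_mul_mem_closure_sup p hm (LayerField.emb_mem y)
    (by rw [LayerField.norm_emb]; exact hμ₀y) 3
  obtain ⟨z, hz, ν, hν, hzν⟩ := AddSubgroup.mem_sup.mp hdec
  have hνL : ν ∈ layer p (m - 1) := hν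
  -- local surjectivity: `p³ y' = Λ(p • RK)`
  set y'K : LayerField p m := LayerField.mk p m y'Ω hy'L with hy'K
  have hp1 : ‖(p : LayerField p m)‖ = (p : ℝ)⁻¹ := by
    rw [← LayerField.norm_emb, map_natCast, ← map_natCast (algebraMap ℚ_[p] (PadicAlgCl p)) p]
    exact (PadicAlgCl.norm_extends (p := p) (p : ℚ_[p])).trans Padic.norm_p
  have htarget : ‖(p : LayerField p m) ^ 2 * y'K‖ ≤ 1 / 4 := by
    rw [norm_mul, norm_pow, hp1]
    have hy'n : ‖y'K‖ ≤ 1 := by rw [hy'K, ← LayerField.norm_emb, LayerField.emb_mk]; exact hy'1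
    have hp2' : (2 : ℝ) ≤ p := by exact_mod_cast hp.out.two_le
    have hinv : (p : ℝ)⁻¹ ≤ 1 / 2 := by rw [one_div]; exact inv_anti₀ two_pos hp2'
    calc (p : ℝ)⁻¹ ^ 2 * ‖y'K‖ ≤ (1 / 2) ^ 2 * 1 :=
          mul_le_mul (pow_le_pow_left₀ (by positivity) hinv 2) hy'n (norm_nonneg _) (by positivity)
      _ = 1 / 4 := by norm_num
  obtain ⟨RK, hRKk, hΛR, -⟩ := exists_ptLog_eq (p := p) (M := M) htarget
  have hΛpR : ptLog p (LayerField p m) M (p • RK) = (p : LayerField p m) ^ 3 * y'K := by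
    rw [ptLog_nsmul hRKk, hΛR]; ring
  -- the `Γ`-combination of conjugates of `c_m`
  obtain ⟨B, hB, hBL, hBk, hBz⟩ := exists_closure_pt act hact0 hact hm hz
  set νB := ptLogΩ p M B - z with hνB
  -- assemble
  refine ⟨B, hB, toOmega p M m RK, toOmega_mem_subfieldPoints _, (toOmega_mem_kernel_iff RK).mpr hRKk, ?_⟩
  have hPRL : toOmega p M m PK - B - p • toOmega p M m RK ∈ subfieldPoints (genFibΩ p M) (layer p m).toSubfield coeffs_mem_layer :=
    (subfieldPoints _ _ _).sub_mem ((subfieldPoints _ _ _).sub_mem (toOmega_mem_subfieldPoints _) hBL)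
      ((subfieldPoints _ _ _).nsmul_mem (toOmega_mem_subfieldPoints _) _)
  have hpRk : p • toOmega p M m RK ∈ kernel (Valued.v (R := PadicAlgCl p)) (genFibΩ p M) :=
    (kernel (Valued.v (R := PadicAlgCl p)) (genFibΩ p M)).nsmul_mem ((toOmega_mem_kernel_iff RK).mpr hRKk) _
  have hPRk : toOmega p M m PK - B - p • toOmega p M m RK ∈ kernel (Valued.v (R := PadicAlgCl p)) (genFibΩ p M) :=
    (kernel (Valued.v (R := PadicAlgCl p)) (genFibΩ p M)).sub_mem ((kernel (Valued.v (R := PadicAlgCl p)) (genFibΩ p M)).sub_mem hPk hBk) hpRk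
  refine mem_subfieldPoints_of_ptLogΩ_mem act hact0 hact htors hPRL hPRk ?_
  -- the logarithm of `P − B − p•R`
  have hΛP : ptLogΩ p M (toOmega p M m PK) = LayerField.emb p m μ₀ + LayerField.emb p m y := by
    rw [ptLogΩ_toOmega hPKk, hy, ← map_add]; congr 1; ring
  have hΛpR' : ptLogΩ p M (p • toOmega p M m RK) = (p : PadicAlgCl p) ^ 3 * y'Ω := by
    rw [← map_nsmul, ptLogΩ_toOmega ((kernel (NormedField.valuation (K := LayerField p m))
      (curveK p (LayerField p m) M)).nsmul_mem hRKk _), hΛpR, map_mul, map_pow, map_natCast, hy'K, LayerField.emb_mk]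
  rw [ptLogΩ_sub (m := m) ((subfieldPoints _ _ _).sub_mem (toOmega_mem_subfieldPoints _) hBL)
      ((subfieldPoints _ _ _).nsmul_mem (toOmega_mem_subfieldPoints _) _)
      ((kernel (Valued.v (R := PadicAlgCl p)) (genFibΩ p M)).sub_mem hPk hBk) hpRk,
    ptLogΩ_sub (m := m) (toOmega_mem_subfieldPoints _) hBL hPk hBk, hΛP, hΛpR']
  have eB : ptLogΩ p M B = z + νB := by rw [hνB]; ring
  rw [eB]
  have e : LayerField.emb p m μ₀ + LayerField.emb p m y - (z + νB) - (p : PadicAlgCl p) ^ 3 * y'Ω =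
      LayerField.emb p m μ₀ + ν - νB + (LayerField.emb p m y - (p : PadicAlgCl p) ^ 3 * y'Ω - (z + ν)) := by ring
  rw [e, hzν, sub_self, add_zero]
  exact IntermediateField.sub_mem _ (IntermediateField.add_mem _ hμ₀L hνL) hBz

/-! ## §3 The trace relations -/

/-- **The trace relation of [K] Lemma 8.9, `m ≥ 1`**: `(∑_{q ∈ stab m / stab (m+1)} act q̃ c_{m+1}) + c_{m−1}`
has logarithm `−p`, hence lies in `L(0) = E(ℚ_p)` (given no `p`-power torsion in `L(m+1)`).
[cite: Kobayashi2003, Lemma 8.9] -/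
theorem sum_act_cPt_add_mem (act : Field.absoluteGaloisGroup ℚ_[p] → (genFibΩ p M).toAffine.Point → (genFibΩ p M).toAffine.Point)
    (hact0 : ∀ σ, act σ 0 = 0)
    (hact : ∀ σ (x y : PadicAlgCl p) (h : (genFibΩ p M).toAffine.Nonsingular x y),
      ∃ h', act σ (Affine.Point.some x y h) = Affine.Point.some (σ • x) (σ • y) h')
    {m : ℕ} (hm : 1 ≤ m)
    [Fintype (stab p m ⧸ (stab p (m + 1)).subgroupOf (stab p m))]
    (htors : ∀ Q ∈ subfieldPoints (genFibΩ p M) (layer p (m + 1)).toSubfield coeffs_mem_layer, ∀ k : ℕ, p ^ k • Q = 0 → Q = 0) :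
    (∑ q : stab p m ⧸ (stab p (m + 1)).subgroupOf (stab p m), act ((q.out : stab p m) : Field.absoluteGaloisGroup ℚ_[p]) (cPt p M hp2 htr (m + 1))) +
        cPt p M hp2 htr (m - 1) ∈ subfieldPoints (genFibΩ p M) (layer p 0).toSubfield coeffs_mem_layer := by
  haveI := isIntegral_curveK p (LayerField p (m + 1)) M
  have hcL := cPt_mem_subfieldPoints (p := p) (M := M) (hp2 := hp2) (htr := htr) (m + 1)
  have hck : cPt p M hp2 htr (m + 1) ∈ kernel (Valued.v (R := PadicAlgCl p)) (genFibΩ p M) := cPt_mem_kernel (m + 1)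
  have hcz : ‖(cPt p M hp2 htr (m + 1)).zCoord‖ < 1 := by
    have := val_zCoord_lt_one hck
    rwa [PadicAlgCl.valuation_def, ← NNReal.coe_lt_coe, coe_nnnorm, NNReal.coe_one] at this
  have hSL : (∑ q : stab p m ⧸ (stab p (m + 1)).subgroupOf (stab p m), act ((q.out : stab p m) : Field.absoluteGaloisGroup ℚ_[p]) (cPt p M hp2 htr (m + 1))) ∈
      subfieldPoints (genFibΩ p M) (layer p (m + 1)).toSubfield coeffs_mem_layer :=
    (subfieldPoints _ _ _).sum_mem fun q _ => act_mem_subfieldPoints act hact0 hact _ hcL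
  have hSk : (∑ q : stab p m ⧸ (stab p (m + 1)).subgroupOf (stab p m), act ((q.out : stab p m) : Field.absoluteGaloisGroup ℚ_[p]) (cPt p M hp2 htr (m + 1))) ∈
      kernel (Valued.v (R := PadicAlgCl p)) (genFibΩ p M) :=
    (kernel (Valued.v (R := PadicAlgCl p)) (genFibΩ p M)).sum_mem fun q _ => act_mem_kernel act hact0 hact _ hck
  have hc'L : cPt p M hp2 htr (m - 1) ∈ subfieldPoints (genFibΩ p M) (layer p (m + 1)).toSubfield coeffs_mem_layer :=
    subfieldPoints_layer_mono (by omega) (cPt_mem_subfieldPoints _)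
  have hc'k : cPt p M hp2 htr (m - 1) ∈ kernel (Valued.v (R := PadicAlgCl p)) (genFibΩ p M) := cPt_mem_kernel (m - 1)
  refine mem_subfieldPoints_of_ptLogΩ_mem act hact0 hact htors
    ((subfieldPoints _ _ _).add_mem hSL hc'L) ((kernel (Valued.v (R := PadicAlgCl p)) (genFibΩ p M)).add_mem hSk hc'k) ?_
  rw [ptLogΩ_add (m := m + 1) hSL hc'L hSk hc'k,
    ptLogΩ_finset_sum (m := m + 1) _ _ (fun q _ => act_mem_subfieldPoints act hact0 hact _ hcL)
      (fun q _ => act_mem_kernel act hact0 hact _ hck)]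
  simp_rw [ptLogΩ_act act hact0 hact _ hcz, ptLogΩ_cPt]
  rw [sum_smul_ell_succ hm]
  have e : -(p : PadicAlgCl p) - ell p (m - 1) + ell p (m - 1) = -(p : PadicAlgCl p) := by ring
  rw [e]
  exact IntermediateField.neg_mem _ (by exact_mod_cast IntermediateField.natCast_mem (layer p 0) p)

/-- **The trace relation at the bottom**: `∑_{q ∈ Γ / stab 1} act q̃ c_1 ∈ L(0) = E(ℚ_p)` (its logarithm is
`−p`), given no `p`-power torsion in `L(1)`. [cite: Kobayashi2003, Lemma 8.9] -/
theorem sum_act_cPt_one_mem (act : Field.absoluteGaloisGroup ℚ_[p] → (genFibΩ p M).toAffine.Point → (genFibΩ p M).toAffine.Point)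
    (hact0 : ∀ σ, act σ 0 = 0)
    (hact : ∀ σ (x y : PadicAlgCl p) (h : (genFibΩ p M).toAffine.Nonsingular x y),
      ∃ h', act σ (Affine.Point.some x y h) = Affine.Point.some (σ • x) (σ • y) h')
    [Fintype (stab p 0 ⧸ (stab p 1).subgroupOf (stab p 0))]
    (htors : ∀ Q ∈ subfieldPoints (genFibΩ p M) (layer p 1).toSubfield coeffs_mem_layer, ∀ k : ℕ, p ^ k • Q = 0 → Q = 0) :
    (∑ q : stab p 0 ⧸ (stab p 1).subgroupOf (stab p 0), act ((q.out : stab p 0) : Field.absoluteGaloisGroup ℚ_[p]) (cPt p M hp2 htr 1)) ∈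
      subfieldPoints (genFibΩ p M) (layer p 0).toSubfield coeffs_mem_layer := by
  haveI := isIntegral_curveK p (LayerField p 1) M
  have hcL := cPt_mem_subfieldPoints (p := p) (M := M) (hp2 := hp2) (htr := htr) 1
  have hck : cPt p M hp2 htr 1 ∈ kernel (Valued.v (R := PadicAlgCl p)) (genFibΩ p M) := cPt_mem_kernel 1
  have hcz : ‖(cPt p M hp2 htr 1).zCoord‖ < 1 := by
    have := val_zCoord_lt_one hck
    rwa [PadicAlgCl.valuation_def, ← NNReal.coe_lt_coe, coe_nnnorm, NNReal.coe_one] at this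
  have hSL : (∑ q : stab p 0 ⧸ (stab p 1).subgroupOf (stab p 0), act ((q.out : stab p 0) : Field.absoluteGaloisGroup ℚ_[p]) (cPt p M hp2 htr 1)) ∈
      subfieldPoints (genFibΩ p M) (layer p 1).toSubfield coeffs_mem_layer :=
    (subfieldPoints _ _ _).sum_mem fun q _ => act_mem_subfieldPoints act hact0 hact _ hcL
  have hSk : (∑ q : stab p 0 ⧸ (stab p 1).subgroupOf (stab p 0), act ((q.out : stab p 0) : Field.absoluteGaloisGroup ℚ_[p]) (cPt p M hp2 htr 1)) ∈
      kernel (Valued.v (R := PadicAlgCl p)) (genFibΩ p M) :=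
    (kernel (Valued.v (R := PadicAlgCl p)) (genFibΩ p M)).sum_mem fun q _ => act_mem_kernel act hact0 hact _ hck
  refine mem_subfieldPoints_of_ptLogΩ_mem act hact0 hact htors hSL hSk ?_
  rw [ptLogΩ_finset_sum (m := 1) _ _ (fun q _ => act_mem_subfieldPoints act hact0 hact _ hcL)
      (fun q _ => act_mem_kernel act hact0 hact _ hck)]
  simp_rw [ptLogΩ_act act hact0 hact _ hcz, ptLogΩ_cPt]
  rw [sum_smul_ell_one]
  exact IntermediateField.neg_mem _ (by exact_mod_cast IntermediateField.natCast_mem (layer p 0) p)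

end BallEval

end Summit.BirchSwinnertonDyer.Rank1Residual.Additive

end
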